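import Summits.CriticalPhenomena.SAWScalingLimit.Theorems.SAWDevelopingMapHexConjectureRestrictionCocycleOfAspectBound
import Summits.CriticalPhenomena.SAWScalingLimit.Theorems.SAWDevelopingMapHexConjectureAspectBoundOfWindowTwoPoint
import Summits.CriticalPhenomena.SAWScalingLimit.Theorems.HexConjecture.Negative.NonVacuity
import Summits.CriticalPhenomena.SAWScalingLimit.Theses.SAWDevelopingMap
import HarnessLib

/-!
# `HexConjecture` (stmt-CriticalPhenomena-0808) — the DECOMPOSITION GLUE (crux-strategist s1, 2026-08-17)

Duminil-Copin–Smirnov 2012 Conjecture 1 on the honeycomb lattice, as typed in the route files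
(`SAWDevelopingMap.HexConjecture` = `SAWBrickWallHomotopy.HexConjecture` = …, identical bodies), follows from FOUR
statements, each a genuine and strictly smaller piece, by theorems already LANDED in the tree (line
`root-locality-replaces-loewner`, lead seats 0 → c8 of the crux; files `SAWDevelopingMapHexConjecture*.lean`,
namespace `…Theorems.HexConjecture.RootLocality`):

1. `FloorRatioLimit` (FRL) — conformal covariance, with the boundary exponent `5/8`, of RATIOS of positive boundary
   partition functions `Z_δ(a→b')/Z_δ(a→b) → |Φ'(b')/Φ'(b)|^(5/8)` on domains flat at the root `a` and at the two floor
   points `b, b'` (implied by the repaired DCS Conjecture 2, item stmt-CriticalPhenomena-14003, through the landed target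
   transport `RootLocality.floorRatioModulus_of_hexObservableLimit`);
2. `WindowTwoPointLowerBound` (WTLB) — ONE order-of-magnitude inequality for the critical half-plane walk:
   the Glazman–Manolescu triangle tail `triDl ⌊R/4⌋` is dominated by the reference-window boundary two-point mass of the
   half-box of radius `R` ("cube ↦ linear": the cube version is the landed theorem `triDl_cube_le_windowMass`);
3. `UniformModulus` (UIM) — uniform injectivity modulus of the critical hexagonal SAW on floor domains (a-priori
   regularity; implied by Conjecture 1, `Negative.ModulusNecessity`);
4. `BoundaryUniversality` (E) — convergence on the FLOOR class (Jordan domain above the line through its marks, flat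
   half-discs at both, floor-vertex endpoints) implies Conjecture 1 for every Dobrushin domain and every endpoint
   approximation (implied by Conjecture 1).

`HexConjecture_of_subs : FRL → WTLB → UIM → (E) → HexConjecture` composes
`RootLocality.archAspectBound_of_windowTwoPointLowerBound` (WTLB ⟹ arch aspect bound; Glazman–Manolescu Lemma 4.1 =
Krachun–Panagiotis eq. (2) + DCS Lemma 2), `RootLocality.hexConjectureFloor_of_aspectEstimates` (FRL + aspect bound + UIM ⟹
SLE(8/3) convergence on the floor class with discrete-boundary endpoints: exact lattice restriction, the floor-ratio
bootstrap, LSW restriction uniqueness, range identification, curve upgrade) and the elementary passage from floor-vertex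
endpoints to discrete-boundary endpoints (`stub_discreteBoundary_of_floorVertex`, the argument of the line's `…BoundaryUniversality.lean` inlined).
It is the `--glue-by` theorem of the route-level split of the crux filed by this seat; the four hypotheses are stated
VERBATIM as the four child items (fully qualified), the conclusion is the route decl BY NAME.
-/

noncomputable section

namespace Summit.CriticalPhenomena.SAWScalingLimit.Theorems.HexConjecture.Split

open scoped Topology NNReal ENNReal
open Filter Set Metric MeasureTheory
open Literature.Probability.LatticeModels (HexVertex hexGraph hexCenter)
open Literature.Probability.RandomPlanarGeometry
open Literature.Probability.RandomPlanarGeometry.SAW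
open Summit.CriticalPhenomena.SAWScalingLimit.Theorems.HexConjecture

/-- **Registered sub-goal `stub_discreteBoundary_of_floorVertex`** (crux item stmt-CriticalPhenomena-0808, strategist s1):
the endpoint-class passage used by the decomposition glue, fully qualified (floor-vertex endpoints are discrete-boundary
endpoints, eventually, on floor domains).
[folklore] -/
theorem stub_discreteBoundary_of_floorVertex : ∀ {D : Literature.Probability.RandomPlanarGeometry.DobrushinDomain} {a b : ℝ → Literature.Probability.LatticeModels.HexVertex}, D.carrier ⊆ {z : ℂ | (D.pt 0).im < z.im} → (D.pt 1).im = (D.pt 0).im → Literature.Probability.RandomPlanarGeometry.SAW.IsEmbEndpointApprox Literature.Probability.LatticeModels.hexGraph Literature.Probability.LatticeModels.hexCenter D a b → (∀ᶠ δ : ℝ in nhdsWithin (0 : ℝ) (Set.Ioi 0), (∃ u : Literature.Probability.LatticeModels.HexVertex, Literature.Probability.LatticeModels.hexGraph.Adj (a δ) u ∧ ((δ : ℂ) * Literature.Probability.LatticeModels.hexCenter u).im ≤ (D.pt 0).im) ∧ (∃ u : Literature.Probability.LatticeModels.HexVertex, Literature.Probability.LatticeModels.hexGraph.Adj (b δ)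 u ∧ ((δ : ℂ) * Literature.Probability.LatticeModels.hexCenter u).im ≤ (D.pt 1).im)) → ∀ᶠ δ : ℝ in nhdsWithin (0 : ℝ) (Set.Ioi 0), (a δ ∈ Literature.Probability.RandomPlanarGeometry.SAW.embMeshDomain Literature.Probability.LatticeModels.hexGraph Literature.Probability.LatticeModels.hexCenter D.carrier δ ∧ ∃ w, Literature.Probability.LatticeModels.hexGraph.Adj (a δ) w ∧ ¬ (Literature.Probability.RandomPlanarGeometry.SAW.hexDomainGraph D.carrier δ).Adj (a δ) w) ∧ (b δ ∈ Literature.Probability.RandomPlanarGeometry.SAW.embMeshDomain Literature.Probability.LatticeModels.hexGraph Literature.Probability.LatticeModels.hexCenter D.carrier δ ∧ ∃ w, Literature.Probability.LatticeModels.hexGraph.Adj (b δ) w ∧ ¬ (Literature.Probability.RandomPlanarGeometry.SAW.hexDomainGraph D.carrier δ).Adj (b δ) w) := by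
  intro D a b hD h01 hab hfl
  -- no `Ω_δ`-edge reaches a vertex whose rescaled centre is on or below the floor line
  have hbelow : ∀ {δ : ℝ} {v u : HexVertex}, ((δ : ℂ) * hexCenter u).im ≤ (D.pt 0).im →
      ¬ (hexDomainGraph D.carrier δ).Adj v u := by
    intro δ v u hu hadj
    have huΩ : u ∈ embMeshDomain hexGraph hexCenter D.carrier δ := ((embDomainGraph_adj_iff _ _).1 hadj).2.2
    have : (D.pt 0).im < ((δ : ℂ) * hexCenter u).im := hD (embMeshDomain_subset _ _ _ _ huΩ)
    exact absurd this (not_lt.2 hu)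
  -- distinct vertices joined in `Ω_δ` are vertices of `Ω_δ`
  have hmem : ∀ {δ : ℝ} {u v : HexVertex}, u ≠ v → (hexDomainGraph D.carrier δ).Reachable u v →
      u ∈ embMeshDomain hexGraph hexCenter D.carrier δ := by
    intro δ u v huv h
    obtain ⟨p⟩ := h
    cases p with
    | nil => exact absurd rfl huv
    | cons hadj _ => exact ((embDomainGraph_adj_iff _ _).1 hadj).2.1
  filter_upwards [hfl, hab.reachable,
    Summit.CriticalPhenomena.SAWScalingLimit.Cruxes.HexConjecture.NonVacuity.IsEmbEndpointApprox.eventually_ne hab]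
    with δ hδ hreach hne
  obtain ⟨⟨u, hu, hui⟩, ⟨u', hu', hui'⟩⟩ := hδ
  rw [h01] at hui'
  exact ⟨⟨hmem hne hreach, u, hu, hbelow hui⟩, ⟨hmem (Ne.symm hne) hreach.symm, u', hu', hbelow hui'⟩⟩

/-- **DCS Conjecture 1 from its four pieces** (decomposition glue for crux stmt-CriticalPhenomena-0808; registered
sub-goal `HexConjecture_of_subs` of the item): floor-ratio limit → window two-point lower bound → uniform injectivity
modulus → boundary universality → `SAWDevelopingMap.HexConjecture`.  Pure composition of landed theorems of the
restriction line `root-locality-replaces-loewner`.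
[cite: LawlerSchrammWerner2004SAW, §3.4 and Prop. 2; DuminilCopinSmirnov2012, Lemma 2 and Conjecture 1; GlazmanManolescu2019, Lemma 4.1] -/
theorem HexConjecture_of_subs : (∀ (D D' : Literature.Probability.RandomPlanarGeometry.DobrushinDomain) (ρ : ℝ) (Λ : ℝ → Finset Literature.Probability.LatticeModels.HexVertex) (m₀ m m' : ℝ → ℤ) (a b b' : ℝ → Sym2 Literature.Probability.LatticeModels.HexVertex) (Φ : Literature.Probability.RandomPlanarGeometry.ConformalEquiv D.carrier UpperHalfPlane.upperHalfPlaneSet) (L : ℂ → ℂ) (Lb Lb' : ℂ), D'.carrier = D.carrier → D'.pt 0 = D.pt 0 → 0 < ρ → D.carrier ∩ Metric.ball (D.pt 0) ρ = {z : ℂ | (D.pt 0).im < z.im} ∩ Metric.ball (D.pt 0) ρ → D.carrier ∩ Metric.ball (D.pt 1) ρ = {z : ℂ | (D.pt 1).im < z.im} ∩ Metric.ball (D.pt 1) ρ → D.carrier ∩ Metric.ball (D'.pt 1) ρ = {z : ℂ | (D'.pt 1).im < z.im} ∩ Metric.ball (D'.pt 1) ρ → (∀ᶠ δ : ℝ in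 nhdsWithin (0 : ℝ) (Set.Ioi 0), Literature.Probability.RandomPlanarGeometry.SAW.hexDomainSimplyConnected (Λ δ) ∧ a δ ∈ Literature.Probability.RandomPlanarGeometry.SAW.hexDomainBoundary (Λ δ) ∧ b δ ∈ Literature.Probability.RandomPlanarGeometry.SAW.hexDomainBoundary (Λ δ) ∧ b' δ ∈ Literature.Probability.RandomPlanarGeometry.SAW.hexDomainBoundary (Λ δ) ∧ Nonempty (Literature.Probability.RandomPlanarGeometry.SAW.HexMidEdgeSAW (Λ δ) (a δ) (b δ)) ∧ Nonempty (Literature.Probability.RandomPlanarGeometry.SAW.HexMidEdgeSAW (Λ δ) (a δ) (b' δ)) ∧ (Literature.Probability.LatticeModels.hexGraph.induce (↑(Λ δ) : Set Literature.Probability.LatticeModels.HexVertex)).Preconnected ∧ (∀ v ∈ Λ δ, (δ : ℂ) * Literature.Probability.LatticeModels.hexCenter v ∈ D.carrier) ∧ (∀ v : Literature.Probability.LatticeModels.HexVertex, (δ : ℂ) * Literature.Probability.LatticeModels.hexCenter v ∈ Metric.ball (D.pt 0) ρ → (v ∈ Λ δ ↔ m₀ δ ≤ v.1 1)) ∧ (∀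 v : Literature.Probability.LatticeModels.HexVertex, (δ : ℂ) * Literature.Probability.LatticeModels.hexCenter v ∈ Metric.ball (D.pt 1) ρ → (v ∈ Λ δ ↔ m δ ≤ v.1 1)) ∧ (∀ v : Literature.Probability.LatticeModels.HexVertex, (δ : ℂ) * Literature.Probability.LatticeModels.hexCenter v ∈ Metric.ball (D'.pt 1) ρ → (v ∈ Λ δ ↔ m' δ ≤ v.1 1))) → (∀ K : Set ℂ, IsCompact K → K ⊆ D.carrier → ∀ᶠ δ : ℝ in nhdsWithin (0 : ℝ) (Set.Ioi 0), ∀ v : Literature.Probability.LatticeModels.HexVertex, (δ : ℂ) * Literature.Probability.LatticeModels.hexCenter v ∈ K → v ∈ Λ δ) → Filter.Tendsto (fun δ : ℝ => (δ : ℂ) * Literature.Probability.RandomPlanarGeometry.SAW.hexMidpoint (a δ)) (nhdsWithin (0 : ℝ) (Set.Ioi 0)) (nhds (D.pt 0)) → Filter.Tendsto (fun δ : ℝ => (δ : ℂ) * Literature.Probability.RandomPlanarGeometry.SAW.hexMidpoint (b δ)) (nhdsWithin (0 : ℝ) (Set.Ioi 0)) (nhds (D.pt 1)) → Filter.Tendsto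 (fun δ : ℝ => (δ : ℂ) * Literature.Probability.RandomPlanarGeometry.SAW.hexMidpoint (b' δ)) (nhdsWithin (0 : ℝ) (Set.Ioi 0)) (nhds (D'.pt 1)) → Filter.Tendsto (fun x => ‖Φ x‖) (nhdsWithin (D.pt 0) D.carrier) Filter.atTop → Φ.HasBoundaryValue (D.pt 1) 0 → ContinuousOn L D.carrier → (∀ z ∈ D.carrier, Complex.exp (L z) = deriv Φ z) → Filter.Tendsto L (nhdsWithin (D.pt 1) D.carrier) (nhds Lb) → Filter.Tendsto L (nhdsWithin (D'.pt 1) D.carrier) (nhds Lb') → Filter.Tendsto (fun δ : ℝ => ‖Literature.Probability.RandomPlanarGeometry.SAW.hexParafermionicObservable (Λ δ) (a δ) Literature.Probability.RandomPlanarGeometry.SAW.hexCriticalFugacity (5 / 8) (b' δ) / Literature.Probability.RandomPlanarGeometry.SAW.hexParafermionicObservable (Λ δ) (a δ) Literature.Probability.RandomPlanarGeometry.SAW.hexCriticalFugacity (5 / 8) (b δ)‖) (nhdsWithin (0 : ℝ) (Set.Ioi 0)) (nhds (Real.exp ((5 / 8) * (Lb' - Lb).re)))) → (∃ θa θb C :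 ℝ, 0 < θa ∧ θa < θb ∧ θb ≤ 1 / 4 ∧ 0 < C ∧ ∃ R₀ : ℝ, 0 < R₀ ∧ ∀ R : ℝ, R₀ ≤ R → ∀ (x : Literature.Probability.LatticeModels.Site 2) (B : Finset Literature.Probability.LatticeModels.HexVertex) (S' : Finset ℤ), (∀ v : Literature.Probability.LatticeModels.HexVertex, v ∈ B ↔ (x 1 ≤ v.1 1 ∧ dist (Literature.Probability.LatticeModels.hexCenter v) (Literature.Probability.RandomPlanarGeometry.SAW.hexMidpoint s((x - Pi.single 1 1, 1), (x, 0))) ≤ R)) → (∀ d : ℤ, d ∈ S' ↔ (θa * R ≤ (d : ℝ) ∧ (d : ℝ) ≤ θb * R)) → Literature.Probability.RandomPlanarGeometry.SAW.HV.triDl ⌊R / 4⌋₊ ≤ C * ∑ d ∈ S', ∑ γ : Literature.Probability.RandomPlanarGeometry.SAW.HexMidEdgeSAW B s((x - Pi.single 1 1, 1), (x, 0)) s((x + Pi.single 0 d - Pi.single 1 1, 1), (x + Pi.single 0 d, 0)), Literature.Probability.RandomPlanarGeometry.SAW.hexCriticalFugacity ^ γ.length) → (∀ (D : Literature.Probability.RandomPlanarGeometry.DobrushinDomain)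 (ρ : ℝ) (a b : ℝ → Literature.Probability.LatticeModels.HexVertex), (0 < ρ ∧ (D.pt 1).im = (D.pt 0).im ∧ D.carrier ⊆ {z : ℂ | (D.pt 0).im < z.im} ∧ D.carrier ∩ Metric.ball (D.pt 0) ρ = {z : ℂ | (D.pt 0).im < z.im} ∩ Metric.ball (D.pt 0) ρ ∧ D.carrier ∩ Metric.ball (D.pt 1) ρ = {z : ℂ | (D.pt 1).im < z.im} ∩ Metric.ball (D.pt 1) ρ) → (Literature.Probability.RandomPlanarGeometry.SAW.IsEmbEndpointApprox Literature.Probability.LatticeModels.hexGraph Literature.Probability.LatticeModels.hexCenter D a b ∧ ∀ᶠ δ : ℝ in nhdsWithin (0 : ℝ) (Set.Ioi 0), (∃ u : Literature.Probability.LatticeModels.HexVertex, Literature.Probability.LatticeModels.hexGraph.Adj (a δ) u ∧ ((δ : ℂ) * Literature.Probability.LatticeModels.hexCenter u).im ≤ (D.pt 0).im) ∧ (∃ u : Literature.Probability.LatticeModels.HexVertex, Literature.Probability.LatticeModels.hexGraph.Adj (b δ) u ∧ ((δ : ℂ) * Literature.Probability.LatticeModels.hexCenter u).im ≤ (D.pt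 1).im)) → ∀ ε η : ℝ, 0 < ε → 0 < η → ∃ θ : ℝ, 0 < θ ∧ ∀ᶠ δ : ℝ in nhdsWithin (0 : ℝ) (Set.Ioi 0), Literature.Probability.RandomPlanarGeometry.SAW.hexSAWLaw D.carrier δ (a δ) (b δ) {γ | γ.curve ∉ Literature.Probability.RandomPlanarGeometry.CurveClass.modulusClass ε θ} ≤ ENNReal.ofReal η) → ((∀ (D : Literature.Probability.RandomPlanarGeometry.DobrushinDomain) (ρ : ℝ) (a b : ℝ → Literature.Probability.LatticeModels.HexVertex), (0 < ρ ∧ (D.pt 1).im = (D.pt 0).im ∧ D.carrier ⊆ {z : ℂ | (D.pt 0).im < z.im} ∧ D.carrier ∩ Metric.ball (D.pt 0) ρ = {z : ℂ | (D.pt 0).im < z.im} ∩ Metric.ball (D.pt 0) ρ ∧ D.carrier ∩ Metric.ball (D.pt 1) ρ = {z : ℂ | (D.pt 1).im < z.im} ∩ Metric.ball (D.pt 1) ρ) → (Literature.Probability.RandomPlanarGeometry.SAW.IsEmbEndpointApprox Literature.Probability.LatticeModels.hexGraph Literature.Probability.LatticeModels.hexCenter D a b ∧ ∀ᶠ δ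 : ℝ in nhdsWithin (0 : ℝ) (Set.Ioi 0), (∃ u : Literature.Probability.LatticeModels.HexVertex, Literature.Probability.LatticeModels.hexGraph.Adj (a δ) u ∧ ((δ : ℂ) * Literature.Probability.LatticeModels.hexCenter u).im ≤ (D.pt 0).im) ∧ (∃ u : Literature.Probability.LatticeModels.HexVertex, Literature.Probability.LatticeModels.hexGraph.Adj (b δ) u ∧ ((δ : ℂ) * Literature.Probability.LatticeModels.hexCenter u).im ≤ (D.pt 1).im)) → Literature.Probability.RandomPlanarGeometry.ConvergesInLawToSLE ((8 : NNReal) / 3) D (fun δ (γ : Literature.Probability.RandomPlanarGeometry.SAW.HexDomainSAW D.carrier δ (a δ) (b δ)) => γ.curve) (fun δ => Literature.Probability.RandomPlanarGeometry.SAW.hexSAWLaw D.carrier δ (a δ) (b δ))) → ∀ (D : Literature.Probability.RandomPlanarGeometry.DobrushinDomain) (a b : ℝ → Literature.Probability.LatticeModels.HexVertex), Literature.Probability.RandomPlanarGeometry.SAW.IsEmbEndpointApprox Literature.Probability.LatticeModels.hexGraph Literature.Probability.LatticeModels.hexCenter D a b → Literature.Probability.RandomPlanarGeometry.ConvergesInLawToSLE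 ((8 : NNReal) / 3) D (fun δ (γ : Literature.Probability.RandomPlanarGeometry.SAW.HexDomainSAW D.carrier δ (a δ) (b δ)) => γ.curve) (fun δ => Literature.Probability.RandomPlanarGeometry.SAW.hexSAWLaw D.carrier δ (a δ) (b δ))) → Summit.CriticalPhenomena.SAWScalingLimit.Theses.SAWDevelopingMap.HexConjecture := by
  intro hF hW hU hE
  refine hE ?_
  intro D ρ a b hfl hend
  exact RootLocality.hexConjectureFloor_of_aspectEstimates hF
    (RootLocality.archAspectBound_of_windowTwoPointLowerBound hW) hU D ρ a b hfl hend.1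
    (stub_discreteBoundary_of_floorVertex hfl.2.2.1 hfl.2.1 hend.1 hend.2)

end Summit.CriticalPhenomena.SAWScalingLimit.Theorems.HexConjecture.Split

end
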